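import Summits.AtomisticToContinuum.BoseEinsteinCondensation.Theorems.BlockLatticeFSumKinematics
import HarnessLib

/-!
# Mode-counting kit for the block-wave span (Theses-free)  (decomp-a2c · hand-1 g9, critic row 420 (2))

Route-independent bookkeeping shared by the mode-counting steps of the BEC block lines
(`BlockLatticeFSum.ShellModeCounting` 27508, `BECIntegerBlockRotor.BlockModeCounting` 13597, and the pieces
MF / SB / MC of the `BoxLatticeFSum` carving of 27506), stated in GENERAL form so that consumers import THIS
module (which imports only the Theses-free kinematics kit `BlockLatticeFSumKinematics`) instead of a module in
some route's import cone (gate `lint.theses-cone`):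

* `cellOccupation_blockWave_of_coords_zero` — a block plane wave all of whose coordinates vanish is the
  constant mode on the cell: `n(f_q) = condensateOccupation` (the `h0` step of both mode-counting proofs);
* `zero_mode_ge_of_le` — counting in `ℝ≥0∞` with free fractions: total `≥ (1 − η₁)N`, non-zero modes
  `≤ η₂ N` ⟹ zero mode `≥ (1 − η₁ − η₂)N`;
* `sum_le_ofReal_mul_of_le` — summing termwise bounds `n_q ≤ ofReal (C·g_q)` against `Σ g_q ≤ B`;
* `eq_zero_index_iff` / `not_forall_dvd_of_ne_zero` — the zero block index and the `q ≢ 0 (mod K)` side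
  condition of infrared-bound hypotheses, for `q : Fin 3 → Fin K`.

No definitions, no `sorry`. [folklore]
-/

noncomputable section

open MeasureTheory Complex Finset
open scoped ENNReal NNReal BigOperators

namespace Summit.AtomisticToContinuum.BoseEinsteinCondensation.Theorems.BlockLatticeFSumModeCountingKit

open Literature.MathematicalPhysics.QuantumManyBody.BoseGas
open Summit.AtomisticToContinuum.BoseEinsteinCondensation.Theses.BlockLatticeFSum

/-! ## The zero block wave -/

/-- A block index with all coordinates zero gives the constant block wave: on the cell it equals
`constantMode L`. [folklore] -/
theorem blockWave_eq_constantMode_of_coords_zero {L : ℝ} {K : ℕ} {q : Fin 3 → Fin K}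
    (hq : ∀ j : Fin 3, ((q j : ℕ) : ℝ) = 0) (x : EuclideanSpace ℝ (Fin 3)) (hx : x ∈ cell L) :
    (fun x : EuclideanSpace ℝ (Fin 3) => (((Real.sqrt (L ^ 3))⁻¹ : ℝ) : ℂ) *
      Complex.exp (((2 * Real.pi * (∑ j : Fin 3, ((q j : ℕ) : ℝ) * (⌊(K : ℝ) * x j / L⌋ : ℝ)) /
        (K : ℝ) : ℝ) : ℂ) * Complex.I)) x = constantMode L x := by
  simp [hq, constantMode, Set.indicator_of_mem hx, Complex.ofReal_inv]

/-- **Zero mode = condensate mode**: the cell occupation of a block plane wave with all coordinates zero is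
the condensate occupation. [folklore] -/
theorem cellOccupation_blockWave_of_coords_zero {N : ℕ} {L : ℝ} {K : ℕ} {q : Fin 3 → Fin K}
    (hq : ∀ j : Fin 3, ((q j : ℕ) : ℝ) = 0) (Ψ : Config N → ℂ) :
    cellOccupation N L (fun x : EuclideanSpace ℝ (Fin 3) => (((Real.sqrt (L ^ 3))⁻¹ : ℝ) : ℂ) *
      Complex.exp (((2 * Real.pi * (∑ j : Fin 3, ((q j : ℕ) : ℝ) * (⌊(K : ℝ) * x j / L⌋ : ℝ)) /
        (K : ℝ) : ℝ) : ℂ) * Complex.I)) Ψ = condensateOccupation N L Ψ := by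
  rw [Kinematics.cellOccupation_congr (blockWave_eq_constantMode_of_coords_zero hq)]
  simp [cellOccupation, condensateOccupation, constantMode, Set.indicator_indicator]

/-- The zero index `fun _ => 0 : Fin 3 → Fin K` (`K > 0`) has all coordinates zero. [folklore] -/
theorem coords_zero_of_eq {K : ℕ} (hK : 0 < K) {q : Fin 3 → Fin K}
    (hq : q = fun _ => (⟨0, hK⟩ : Fin K)) : ∀ j : Fin 3, ((q j : ℕ) : ℝ) = 0 := by
  intro j; subst hq; simp

/-- `q ≠ 0` in `(Fin K)³` means some coordinate is not divisible by `K` (as integers) — the side condition of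
the block infrared bound. [folklore] -/
theorem not_forall_dvd_of_ne_zero {K : ℕ} (hK : 0 < K) {q : Fin 3 → Fin K}
    (hq : q ≠ fun _ => (⟨0, hK⟩ : Fin K)) : ¬ (∀ j : Fin 3, (K : ℤ) ∣ (((q j : ℕ) : ℤ))) := by
  intro hall
  apply hq
  funext j
  have hdj : K ∣ (q j : ℕ) := by exact_mod_cast hall j
  exact Fin.ext (Nat.eq_zero_of_dvd_of_lt hdj (q j).isLt)

/-! ## Counting in `ℝ≥0∞` -/

/-- **Mode counting with free fractions**: if the total mass over a finite index set is `≥ (1 − η₁)N` and the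
mass off the index `q₀` is `≤ η₂ N` (`η₂ ≥ 0`, `η₁ + η₂ ≤ 1`, `N ≥ 0`), then the mass at `q₀` is
`≥ (1 − η₁ − η₂)N`. [folklore] -/
theorem zero_mode_ge_of_le {ι : Type*} [Fintype ι] [DecidableEq ι] (n : ι → ℝ≥0∞) (q₀ : ι)
    {N η₁ η₂ : ℝ} (hN : 0 ≤ N) (hη₂ : 0 ≤ η₂) (hη : η₁ + η₂ ≤ 1)
    (hP : ENNReal.ofReal ((1 - η₁) * N) ≤ ∑ q, n q)
    (hS : ∑ q ∈ univ.erase q₀, n q ≤ ENNReal.ofReal (η₂ * N)) :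
    ENNReal.ofReal ((1 - η₁ - η₂) * N) ≤ n q₀ := by
  rw [← Finset.add_sum_erase univ n (Finset.mem_univ q₀)] at hP
  have h1 : ENNReal.ofReal ((1 - η₁) * N) =
      ENNReal.ofReal ((1 - η₁ - η₂) * N) + ENNReal.ofReal (η₂ * N) := by
    rw [← ENNReal.ofReal_add (mul_nonneg (by linarith) hN) (mul_nonneg hη₂ hN)]
    congr 1; ring
  have h2 : ENNReal.ofReal ((1 - η₁ - η₂) * N) + ENNReal.ofReal (η₂ * N) ≤
      n q₀ + ENNReal.ofReal (η₂ * N) := by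
    rw [← h1]
    exact hP.trans (add_le_add le_rfl hS)
  exact (ENNReal.add_le_add_iff_right ENNReal.ofReal_ne_top).1 h2

/-- **Summing termwise real bounds in `ℝ≥0∞`**: `n_q ≤ ofReal (C·g_q)` on `s` with `C ≥ 0`, `g ≥ 0` and
`Σ_s g ≤ B` give `Σ_s n ≤ ofReal (C·B)`. [folklore] -/
theorem sum_le_ofReal_mul_of_le {ι : Type*} (s : Finset ι) (n : ι → ℝ≥0∞) (g : ι → ℝ) {C B : ℝ}
    (hC : 0 ≤ C) (hg : ∀ q ∈ s, 0 ≤ g q) (hn : ∀ q ∈ s, n q ≤ ENNReal.ofReal (C * g q))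
    (hB : ∑ q ∈ s, g q ≤ B) : ∑ q ∈ s, n q ≤ ENNReal.ofReal (C * B) := by
  calc ∑ q ∈ s, n q ≤ ∑ q ∈ s, ENNReal.ofReal (C * g q) := Finset.sum_le_sum hn
    _ = ENNReal.ofReal (∑ q ∈ s, C * g q) :=
        (ENNReal.ofReal_sum_of_nonneg fun q hq => mul_nonneg hC (hg q hq)).symm
    _ ≤ ENNReal.ofReal (C * B) := by
        refine ENNReal.ofReal_le_ofReal ?_
        rw [← Finset.mul_sum]
        exact mul_le_mul_of_nonneg_left hB hC

/-- The `ℝ≥0∞` split used with `le_periodicCondensateNumber`: `ofReal ((1-η)N) = ofReal N − ofReal (ηN)` for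
`0 ≤ η`, `0 ≤ N`. [folklore] -/
theorem ofReal_one_sub_mul {η N : ℝ} (hη : 0 ≤ η) (hN : 0 ≤ N) :
    ENNReal.ofReal ((1 - η) * N) = ENNReal.ofReal N - ENNReal.ofReal (η * N) := by
  rw [← ENNReal.ofReal_sub _ (mul_nonneg hη hN)]
  congr 1; ring

end Summit.AtomisticToContinuum.BoseEinsteinCondensation.Theorems.BlockLatticeFSumModeCountingKit

end
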